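import Literature.NumberTheory.LFunctions.ZeroDensityGuthMaynardWindow
import HarnessLib

/-!
# Zero detection at `τ₀ = 3/2`: density-hypothesis-strength large values on `T^{2/3} ≤ N ≤ T` imply the density hypothesis at `σ`

LABEL (line 1): **NOT RH-BEARING** — a zero-DETECTION theorem converts a large values bound for
Dirichlet polynomials into a COUNT of zeros of `ζ` off the critical line; it never empties the
strip (`Literature.Barriers.RiemannHypothesis.LindelofBacklund`). RH-FREE literature. Nothing in
this file bears on the truth of RH.

Topic `NumberTheory/LFunctions`, family RH; bears on the LADDER-RH §4 HELD row `DensityLadder`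
(`Summits/RiemannHypothesis/RiemannHypothesis/Theses/DensityLadder.lean`), crux X2
`DensityBelowBourgain`, whose line of attack (`Cruxes/DensityBelowBourgain/Lines/birth.lean`)
registers the stub DETECT `stub_zeroDetection_threeHalves :
∀ σ, 1/2 < σ → σ < 1 → LargeValuesDHStrength σ → ∀ ε > 0, N(σ, T) = O(T^{2(1−σ)+ε})`. The main
theorem of this file, `isBigO_zetaZeroCountRe_of_largeValuesDHStrength`, has exactly that type with
`LargeValuesDHStrength σ` unfolded (Literature does not import the Summits file), so the stub closes
by `fun σ h₁ h₂ hLV ↦ isBigO_zetaZeroCountRe_of_largeValuesDHStrength h₁ h₂ hLV`.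

Source: T. Tao, T. Trudgian, A. Yang, *New exponent pairs, zero density estimates, and zero additive
energy estimates: a systematic approach* (arXiv:2501.16779, 2025), §6 "zero density estimates from
large value estimates": Corollary 43 — "Let `1/2 < σ < 1` and `τ₀ > 0`. Suppose that one has the
bounds `LV(σ, τ) ≤ (3 − 3σ) τ/τ₀` for `2τ₀/3 ≤ τ ≤ τ₀`, and `LV_ζ(σ, τ) ≤ (3 − 3σ) τ/τ₀` for
`2 ≤ τ < 4τ₀/3`. Then `A(σ) ≤ 3/τ₀`." — at `τ₀ = 3/2`, where the `ζ`-condition is vacuous (proof of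
Theorem 45: "Apply Corollary 43 with `τ₀ = 3/2` (so that (lvoz) is vacuously true)"): in the
variables `N = T^{1/τ}`, `1 ≤ τ ≤ 3/2 ⟺ T^{2/3} ≤ N ≤ T`, `V = N^{σ+o(1)}`, the hypothesis reads
`#W ≲ N^{2τ(1−σ)} = T^{2(1−σ)+o(1)}` (Definition 27, non-asymptotic form), and the conclusion
`A(σ) ≤ 2` is `N(σ, T') ≪ T'^{2(1−σ)+o(1)}` (Definition 37; Lemma 39 is the zero detection, Lemma
33 the power trick placing every short block in the window). This is the classical deduction of a
density theorem from a large values theorem (Jutila 1977 §4 with `Z = T^{2/3}`; Ivić 1985 §11.5).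

## What this file proves (theorems only; no definition, no named fact)

* `isBigO_zetaZeroCountRe_of_largeValuesDHStrength` — for `1/2 < σ < 1`: if for every `ε > 0` there
  are `δ > 0`, `C`, `T₀` such that for `T ≥ T₀`, every `T^{2/3} ≤ N ≤ T`, every `1`-bounded `b` and
  every finite `1`-separated `W ⊂ [0, T]` with `|∑_{N≤n≤2N} b_n n^{it}| ≥ N^{σ−δ}` on `W` one has
  `#W ≤ C T^{2(1−σ)+ε}` (the predicate `LargeValuesDHStrength σ` of the crux line, verbatim), then
  `N(σ, T) = O_ε(T^{2(1−σ)+ε})` for every `ε > 0`.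

The proof is the tree's zero-detection pipeline of `ZeroDensityGuthMaynardWindow.lean`
(Guth–Maynard §13.1), with the abstract hypothesis in place of a specific large values theorem:
fix `σ`, `ε`; take `ε₁ = min(ε/4, (2σ−1)/4)` in the hypothesis (`δ, C_L, T₀`), then
`η ≤ min(ε/60, δ/6, (2σ−1)/60, 1/100)`; `T = 2U`, `l = log T`, zeros `β ≥ σ`, `U < γ ≤ 2U`,
ordinates `≥ 300 l` apart;
* zero detection (`HuxleyZeroDensity.zeroDetection_integral`, `X = T^η`, `Y = T^{1/2}`); the class
  (ii) zeros by the fourth moment of `ζ` (`HuxleyIvic.classTwo_fourth_le`, `zetaFourthMomentWeak`;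
  `classTwo_numeric_dh`, the variant of `GuthMaynardWindow.classTwo_numeric_gm` for every
  `δ₀ = σ − 1/2 > 0`): `≪_{σ} T^{2−2σ+13η}`;
* class (i): dyadic block `(M, 2M]`, `T^η ≤ M ≤ T^{1/2+η/2}`, a power with
  `T^{2/3} ≤ M^k ≤ 2^K T^{1+η}` (`GuthMaynardWindow.exists_power_gm`, `a₁ = 2/3`, `a₂ = 1`),
  coefficients `≪ d(r)^{2k−1} ≪ T^{O(η)}`, dyadic sub-blocks `(P, 2P]`, real parts removed by
  `GuthMaynardWindow.taylor_pigeonhole` (`classOne_card_le_gm`, `dyadicPoly_card_le_gm`);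
* the count on one sub-block (`block_count_dh`): for `P ≤ T` the hypothesis (`realPoints_count_DH`:
  conjugate, divide by `A = E Y₂^η P^{-σ}`; the threshold `V ≥ (3J)^{-K}/(4K)` is `≥ A P^{σ−δ}`
  because `P^δ ≥ T^{2δ/3} ≥ T^{4η} ≥ 4K (51 l)^K 2^K E T^{2η}`), giving `C_L T^{2−2σ+ε₁}`; for
  `T < P ≤ 2^K T^{1+η}` the discrete mean value theorem (`GuthMaynardWindow.realPoints_count_MVT`),
  giving `≪ P^{2−2σ} T^{O(η)} ≤ T^{2−2σ+O(η)}`;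
* thinning (`HuxleyZeroDensity.card_le_of_thinning`), Jensen windows and dyadic summation
  (`ZeroDensity.wellSpacedBound_of_eventually`, `count_dyadic_le`, `isBigO_of_dyadic`).

## References

* T. Tao, T. Trudgian, A. Yang, arXiv:2501.16779 (2025), Definition 27, Lemma 33, Definition 37,
  Lemma 39, Corollaries 41–43, Theorem 45. [`TaoTrudgianYang2025`]
* M. Jutila, *Zero-density estimates for L-functions*, Acta Arith. 32 (1977) 55–62, §4. [`Jutila1977`]
* A. Ivić, *The Riemann Zeta-Function* (1985), §11.5. [`Ivic1985`]
* L. Guth, J. Maynard, *New large value estimates for Dirichlet polynomials*, Ann. of Math. (2) 203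
  (2026), §13.1. [`GuthMaynard2026`]
-/

noncomputable section

open Real Set Filter Topology Complex MeasureTheory Finset Asymptotics

namespace Literature.NumberTheory.LFunctions

namespace ZeroDetectionDH

open ZeroDetect (mollifier mollCoeff norm_mollCoeff_le norm_mollifier_le)
open HuxleyZeroDetection (smoothed norm_smoothed_le)
open HuxleyIvic (classTwo_fourth_le log_pow_le eventually_thresholds ten_le_rpow_quarter)
open GuthMaynardWindow (rpow_pow_eq classOne_card_le_gm exists_power_gm realPoints_count_MVT)

/-! ## §1. The hypothesis applied to a block with bounded coefficients -/

/-- **The density-strength large values hypothesis applied to a block with bounded coefficients.**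
Suppose that at the present `T` every `1`-separated `W ⊂ [0, T]` on which a `1`-bounded polynomial
of length `T^{2/3} ≤ N ≤ T` has `|∑_{N≤n≤2N} b(n) n^{it}| ≥ N^{σ−d}` satisfies `#W ≤ R`. If
`T^{2/3} ≤ P ≤ T`, `|a(r)| ≤ A` on `(P, 2P]` (`A > 0`), `A P^{σ−d} ≤ V` and
`|∑_{P<r≤2P} a(r) r^{-it}| ≥ V` on a `1`-separated `W ⊂ [0, T]`, then (conjugating and dividing by
`A`) `#W ≤ R`. [cite: TaoTrudgianYang2025, Definition 27 (the normalisation `J = [0, T]`)] -/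
theorem realPoints_count_DH {T σ d R : ℝ}
    (hLVT : ∀ (N : ℕ) (b : ℕ → ℂ) (W : Finset ℝ), T ^ (2 / 3 : ℝ) ≤ (N : ℝ) → (N : ℝ) ≤ T →
      (∀ n, ‖b n‖ ≤ 1) → (∀ t ∈ W, 0 ≤ t ∧ t ≤ T) →
      (∀ t ∈ W, ∀ t' ∈ W, t ≠ t' → 1 ≤ |t - t'|) →
      (∀ t ∈ W, (N : ℝ) ^ (σ - d) ≤
        ‖∑ n ∈ Finset.Icc N (2 * N), b n * (n : ℂ) ^ ((t : ℂ) * I)‖) →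
      (W.card : ℝ) ≤ R)
    {P : ℕ} (hPlow : T ^ (2 / 3 : ℝ) ≤ (P : ℝ)) (hPT : (P : ℝ) ≤ T) {a : ℕ → ℂ} {A : ℝ}
    (hA : 0 < A) (ha : ∀ r ∈ Finset.Ioc P (2 * P), ‖a r‖ ≤ A) {V : ℝ}
    (hAV : A * (P : ℝ) ^ (σ - d) ≤ V) (W : Finset ℝ)
    (hW : ∀ t ∈ W, 0 ≤ t ∧ t ≤ T) (hsep : ∀ t ∈ W, ∀ t' ∈ W, t ≠ t' → 1 ≤ |t - t'|)
    (hlarge : ∀ t ∈ W, V ≤ ‖∑ r ∈ Finset.Ioc P (2 * P), a r * (r : ℂ) ^ (-((t : ℂ) * I))‖) :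
    (W.card : ℝ) ≤ R := by
  classical
  set b : ℕ → ℂ := fun n ↦ if n ∈ Finset.Ioc P (2 * P) then (starRingEnd ℂ) (a n) / A else 0
    with hb
  have hb1 : ∀ n, ‖b n‖ ≤ 1 := by
    intro n
    rw [hb]; dsimp only
    split_ifs with h
    · rw [norm_div, Complex.norm_conj, Complex.norm_real, Real.norm_of_nonneg hA.le,
        div_le_one hA]
      exact ha n h
    · simp
  have hsub : Finset.Ioc P (2 * P) ⊆ Finset.Icc P (2 * P) := fun n hn ↦ by
    rw [Finset.mem_Ioc] at hn; rw [Finset.mem_Icc]; omega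
  have hsumeq : ∀ t : ℝ, ∑ n ∈ Finset.Icc P (2 * P), b n * (n : ℂ) ^ ((t : ℂ) * I) =
      (starRingEnd ℂ) (∑ r ∈ Finset.Ioc P (2 * P), a r * (r : ℂ) ^ (-((t : ℂ) * I))) / A := by
    intro t
    rw [← Finset.sum_subset hsub (fun n _ hn ↦ by rw [hb]; dsimp only; rw [if_neg hn, zero_mul]),
      map_sum, Finset.sum_div]
    refine Finset.sum_congr rfl fun n hn ↦ ?_
    rw [hb]; dsimp only
    rw [if_pos hn, map_mul, HuxleyLV.conj_natCast_cpow]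
    have : -(starRingEnd ℂ) ((t : ℂ) * I) = (t : ℂ) * I := by
      rw [map_mul, Complex.conj_ofReal, Complex.conj_I]; ring
    rw [this]
    ring
  have hlarge' : ∀ t ∈ W, (P : ℝ) ^ (σ - d) ≤
      ‖∑ n ∈ Finset.Icc P (2 * P), b n * (n : ℂ) ^ ((t : ℂ) * I)‖ := by
    intro t ht
    rw [hsumeq t, norm_div, Complex.norm_conj, Complex.norm_real, Real.norm_of_nonneg hA.le,
      le_div_iff₀ hA]
    calc (P : ℝ) ^ (σ - d) * A = A * (P : ℝ) ^ (σ - d) := mul_comm _ _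
      _ ≤ V := hAV
      _ ≤ _ := hlarge t ht
  exact hLVT P b W hPlow hPT hb1 hW hsep hlarge'

/-! ## §2. The count on one block -/

set_option maxHeartbeats 1000000 in
/-- **The count on one block** (the two cases of the zero-detection argument: the large values
HYPOTHESIS when the block lies in its window `T^{2/3} ≤ P ≤ T`, the mean value theorem when
`T < P ≤ 2^K T^{1+η}`). With `Y₁ = T^{2/3}`, `Y₂ = 2^K T^{1+η}`, a block `(P, 2P]`, `Y₁ ≤ P`,
`2P ≤ Y₂`, coefficients `|a(r)| ≤ E Y₂^η P^{-σ}`, a threshold `V ≥ (3J)^{-K}/(4K)` (`J ≤ 17 log T`),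
`4K·51^K·2^K·E·log^K T ≤ T^{2η}` and `6η ≤ d`, and the hypothesis "`#W ≤ R_L` whenever
`|∑ b(n)n^{it}| ≥ N^{σ−d}` on `W`, `T^{2/3} ≤ N ≤ T`" at this `T`, every `1`-separated set of reals
`t ∈ [0, T]` with `|∑_{P<r≤2P} a(r) r^{-it}| ≥ V` has at most
`R_L + 44(K+3)2^K Q₁² log^{2K+1} T · T^{2−2σ+5η}` elements, `Q₁ = 4K·51^K·2^K·E`.
[cite: TaoTrudgianYang2025, Lemma 39 and Corollary 43] [cite: GuthMaynard2026, Section 13, proof of Theorem 1.2] -/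
theorem block_count_dh {T l σ η d R_L E Y₁ Y₂ : ℝ} {K J : ℕ} (hT1 : 1 ≤ T)
    (hl : l = Real.log T) (hl1 : 1 ≤ l) (hη : 0 < η) (hη1 : η ≤ 1 / 100) (hσ : 1 / 2 ≤ σ)
    (hσ1 : σ ≤ 1) (hηd : 6 * η ≤ d) (hRL : 0 ≤ R_L) (hE1 : 1 ≤ E)
    (hK1 : 1 ≤ K) (hJ1 : 1 ≤ J) (hJ17 : (J : ℝ) ≤ 17 * l)
    (hY₁def : Y₁ = T ^ (2 / 3 : ℝ)) (hY₂def : Y₂ = 2 ^ K * T ^ (1 + η))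
    (hQ : (4 * K * 51 ^ K * 2 ^ K * E) * l ^ K ≤ T ^ (2 * η))
    (hLVT : ∀ (N : ℕ) (b : ℕ → ℂ) (W : Finset ℝ), T ^ (2 / 3 : ℝ) ≤ (N : ℝ) → (N : ℝ) ≤ T →
      (∀ n, ‖b n‖ ≤ 1) → (∀ t ∈ W, 0 ≤ t ∧ t ≤ T) →
      (∀ t ∈ W, ∀ t' ∈ W, t ≠ t' → 1 ≤ |t - t'|) →
      (∀ t ∈ W, (N : ℝ) ^ (σ - d) ≤
        ‖∑ n ∈ Finset.Icc N (2 * N), b n * (n : ℂ) ^ ((t : ℂ) * I)‖) →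
      (W.card : ℝ) ≤ R_L)
    {P : ℕ} {a : ℕ → ℂ} {V : ℝ} {W : Finset ℝ} (hP : 1 ≤ P) (hY₁P : Y₁ ≤ (P : ℝ))
    (h2P : 2 * (P : ℝ) ≤ Y₂)
    (ha : ∀ r ∈ Finset.Ioc P (2 * P), ‖a r‖ ≤ E * Y₂ ^ η * (P : ℝ) ^ (-σ))
    (hV : (1 / (3 * (J : ℝ))) ^ K / K / 4 ≤ V)
    (hW : ∀ t ∈ W, 0 ≤ t ∧ t ≤ T) (hsep : ∀ t ∈ W, ∀ t' ∈ W, t ≠ t' → 1 ≤ |t - t'|)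
    (hlarge : ∀ t ∈ W, V ≤ ‖∑ r ∈ Finset.Ioc P (2 * P), a r * (r : ℂ) ^ (-((t : ℂ) * I))‖) :
    (W.card : ℝ) ≤ R_L + 44 * (K + 3) * 2 ^ K * (4 * K * 51 ^ K * 2 ^ K * E) ^ 2 *
      (l ^ (2 * K + 1) * T ^ ((2 - 2 * σ) + 5 * η)) := by
  -- ### basic quantities
  have hT0 : 0 < T := by linarith
  have hl0 : 0 < l := by linarith
  have hP0 : (0 : ℝ) < P := by exact_mod_cast hP
  have hP1 : (1 : ℝ) ≤ P := by exact_mod_cast hP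
  have hK0 : (0 : ℝ) < K := by exact_mod_cast hK1
  have hK1' : (1 : ℝ) ≤ K := by exact_mod_cast hK1
  have hJ0 : (0 : ℝ) < J := by exact_mod_cast hJ1
  have h2K1 : (1 : ℝ) ≤ 2 ^ K := one_le_pow₀ (by norm_num)
  have hE0 : 0 < E := by linarith
  have hTmono : ∀ e f : ℝ, e ≤ f → T ^ e ≤ T ^ f := fun e f h ↦
    Real.rpow_le_rpow_of_exponent_le hT1 h
  have hTge1 : ∀ e : ℝ, 0 ≤ e → 1 ≤ T ^ e := fun e he ↦ Real.one_le_rpow hT1 he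
  have hY₂1 : 1 ≤ Y₂ := by
    rw [hY₂def]; exact one_le_mul_of_one_le_of_one_le h2K1 (hTge1 _ (by linarith))
  have hY₂0 : 0 < Y₂ := by linarith
  have hPY₂ : (P : ℝ) ≤ Y₂ := by linarith
  have hY₁0 : 0 < Y₁ := by rw [hY₁def]; positivity
  -- `V`
  set V₀ : ℝ := (1 / (3 * (J : ℝ))) ^ K / K / 4 with hV₀
  have hV₀0 : 0 < V₀ := by positivity
  have hV0 : 0 < V := lt_of_lt_of_le hV₀0 hV
  have hVinv : V⁻¹ ≤ 4 * K * (51 * l) ^ K := by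
    have e : V₀⁻¹ = 4 * K * (3 * (J : ℝ)) ^ K := by
      rw [hV₀, div_pow, one_pow, div_div, div_div, one_div, inv_inv]; ring
    have h1 : V⁻¹ ≤ V₀⁻¹ := by rw [inv_le_inv₀ hV0 hV₀0]; exact hV
    rw [e] at h1
    refine h1.trans (mul_le_mul_of_nonneg_left (pow_le_pow_left₀ (by positivity) ?_ K)
      (by positivity))
    linarith
  -- `Y₂^η ≤ 2^K T^{2η}`
  have hY₂η : Y₂ ^ η ≤ 2 ^ K * T ^ (2 * η) := by
    rw [hY₂def, Real.mul_rpow (by positivity) (by positivity), ← Real.rpow_mul hT0.le]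
    refine mul_le_mul ?_ (hTmono _ _ (by nlinarith)) (by positivity) (by positivity)
    calc ((2 : ℝ) ^ K) ^ η ≤ ((2 : ℝ) ^ K) ^ (1 : ℝ) :=
          Real.rpow_le_rpow_of_exponent_le h2K1 (by linarith)
      _ = 2 ^ K := Real.rpow_one _
  -- the normalised coefficient size `A/V ≤ Qb P^{-σ}`, `Qb ≤ T^{4η}`
  set A : ℝ := E * Y₂ ^ η * (P : ℝ) ^ (-σ) with hA
  have hA0 : 0 < A := by positivity
  set Q₁ : ℝ := 4 * K * 51 ^ K * 2 ^ K * E with hQ₁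
  set Qb : ℝ := Q₁ * l ^ K * T ^ (2 * η) with hQb
  have hQ₁1 : 1 ≤ Q₁ := by
    rw [hQ₁]
    have h1 : (1 : ℝ) ≤ 4 * K := by linarith [hK1']
    have h2 : (1 : ℝ) ≤ 51 ^ K := one_le_pow₀ (by norm_num)
    calc (1 : ℝ) = 1 * 1 * 1 * 1 := by ring
      _ ≤ 4 * K * 51 ^ K * 2 ^ K * E := by gcongr
  have hQb1 : 1 ≤ Qb := by
    rw [hQb]
    exact one_le_mul_of_one_le_of_one_le (one_le_mul_of_one_le_of_one_le hQ₁1 (one_le_pow₀ hl1))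
      (hTge1 _ (by positivity))
  have hQb0 : 0 < Qb := by linarith
  have hQb4 : Qb ≤ T ^ (4 * η) := by
    calc Qb = (Q₁ * l ^ K) * T ^ (2 * η) := by rw [hQb]
      _ ≤ T ^ (2 * η) * T ^ (2 * η) := mul_le_mul_of_nonneg_right hQ (by positivity)
      _ = T ^ (4 * η) := by rw [← Real.rpow_add hT0]; ring_nf
  have hAV : A / V ≤ Qb * (P : ℝ) ^ (-σ) := by
    rw [div_eq_mul_inv, hA]
    have h1 : E * Y₂ ^ η * (P : ℝ) ^ (-σ) * V⁻¹ = (E * Y₂ ^ η * V⁻¹) * (P : ℝ) ^ (-σ) := by ring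
    rw [h1]
    refine mul_le_mul_of_nonneg_right ?_ (by positivity)
    calc E * Y₂ ^ η * V⁻¹ ≤ E * (2 ^ K * T ^ (2 * η)) * (4 * K * (51 * l) ^ K) := by gcongr
      _ = Qb := by rw [hQb, hQ₁, mul_pow]; ring
  have hAV0 : 0 ≤ A / V := by positivity
  have hAV2 : (A / V) ^ 2 ≤ Qb ^ 2 * (P : ℝ) ^ (-(2 * σ)) := by
    calc (A / V) ^ 2 ≤ (Qb * (P : ℝ) ^ (-σ)) ^ 2 := pow_le_pow_left₀ hAV0 hAV 2
      _ = Qb ^ 2 * ((P : ℝ) ^ (-σ)) ^ 2 := mul_pow _ _ _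
      _ = Qb ^ 2 * (P : ℝ) ^ (-(2 * σ)) := by rw [rpow_pow_eq hP0.le]; norm_num
  -- `P^{2−2σ} ≤ 2^K T^{2−2σ+η}`
  have hP22 : (P : ℝ) ^ (2 - 2 * σ) ≤ 2 ^ K * T ^ ((2 - 2 * σ) + η) := by
    have h1 : (P : ℝ) ^ (2 - 2 * σ) ≤ Y₂ ^ (2 - 2 * σ) :=
      Real.rpow_le_rpow hP0.le hPY₂ (by linarith)
    refine h1.trans ?_
    rw [hY₂def, Real.mul_rpow (by positivity) (by positivity), ← Real.rpow_mul hT0.le]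
    refine mul_le_mul ?_ (hTmono _ _ ?_) (by positivity) (by positivity)
    · calc ((2 : ℝ) ^ K) ^ (2 - 2 * σ) ≤ ((2 : ℝ) ^ K) ^ (1 : ℝ) :=
            Real.rpow_le_rpow_of_exponent_le h2K1 (by linarith)
        _ = 2 ^ K := Real.rpow_one _
    · have e : (1 + η) * (2 - 2 * σ) = (2 - 2 * σ) + η * (2 - 2 * σ) := by ring
      have : η * (2 - 2 * σ) ≤ η * 1 := mul_le_mul_of_nonneg_left (by linarith) hη.le
      rw [e]; linarith
  rcases le_or_gt (P : ℝ) T with hPT | hTP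
  · -- ### the block lies in the window: the hypothesis
    have hPlow : T ^ (2 / 3 : ℝ) ≤ (P : ℝ) := by rw [← hY₁def]; exact hY₁P
    -- `T^{4η} ≤ P^d`
    have hd0 : 0 < d := by linarith
    have hPd : T ^ (4 * η) ≤ (P : ℝ) ^ d := by
      calc T ^ (4 * η) ≤ T ^ (2 / 3 * d) := hTmono _ _ (by linarith)
        _ = (T ^ (2 / 3 : ℝ)) ^ d := by rw [← Real.rpow_mul hT0.le]
        _ ≤ (P : ℝ) ^ d := Real.rpow_le_rpow (by positivity) hPlow hd0.le
    -- `A P^{σ−d} ≤ V`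
    have hAVd : A * (P : ℝ) ^ (σ - d) ≤ V := by
      have h1 : A * (P : ℝ) ^ (σ - d) = (A / V) * (P : ℝ) ^ (σ - d) * V := by
        field_simp
      have h2 : (A / V) * (P : ℝ) ^ (σ - d) ≤ Qb * (P : ℝ) ^ (-d) := by
        calc (A / V) * (P : ℝ) ^ (σ - d) ≤ (Qb * (P : ℝ) ^ (-σ)) * (P : ℝ) ^ (σ - d) :=
            mul_le_mul_of_nonneg_right hAV (by positivity)
          _ = Qb * ((P : ℝ) ^ (-σ) * (P : ℝ) ^ (σ - d)) := by ring
          _ = Qb * (P : ℝ) ^ (-d) := by rw [← Real.rpow_add hP0]; ring_nf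
      have h3 : Qb * (P : ℝ) ^ (-d) ≤ 1 := by
        rw [Real.rpow_neg hP0.le, ← div_eq_mul_inv, div_le_one (by positivity)]
        exact hQb4.trans hPd
      rw [h1]
      calc (A / V) * (P : ℝ) ^ (σ - d) * V ≤ 1 * V :=
          mul_le_mul_of_nonneg_right (h2.trans h3) hV0.le
        _ = V := one_mul _
    have hLV := realPoints_count_DH hLVT hPlow hPT hA0 ha hAVd W hW hsep hlarge
    have : 0 ≤ 44 * (K + 3) * 2 ^ K * Q₁ ^ 2 * (l ^ (2 * K + 1) * T ^ ((2 - 2 * σ) + 5 * η)) := by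
      positivity
    linarith
  · -- ### a long block: the mean value theorem
    have hMVT := realPoints_count_MVT hT1 hP ha hV0 W hW hsep hlarge
    -- `(A/V)² P (5T + 3 + 36P) ≤ 44 Qb² 2^K T^{2−2σ+η}`
    have hgeom : (A / V) ^ 2 * P * (5 * T + 3 + 36 * P) ≤
        44 * (Qb ^ 2 * (2 ^ K * T ^ ((2 - 2 * σ) + η))) := by
      have e1 : (P : ℝ) ^ (-(2 * σ)) * P = (P : ℝ) ^ (1 - 2 * σ) := by
        conv_lhs => rw [show (P : ℝ) ^ (-(2 * σ)) * P = (P : ℝ) ^ (-(2 * σ)) * (P : ℝ) ^ (1 : ℝ) by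
          rw [Real.rpow_one]]
        rw [← Real.rpow_add hP0]; ring_nf
      have h1 : (A / V) ^ 2 * P * (5 * T + 3 + 36 * P) ≤
          Qb ^ 2 * ((P : ℝ) ^ (1 - 2 * σ) * (5 * T + 3 + 36 * P)) := by
        calc (A / V) ^ 2 * P * (5 * T + 3 + 36 * P)
            ≤ (Qb ^ 2 * (P : ℝ) ^ (-(2 * σ))) * P * (5 * T + 3 + 36 * P) := by gcongr
          _ = Qb ^ 2 * (((P : ℝ) ^ (-(2 * σ)) * P) * (5 * T + 3 + 36 * P)) := by ring
          _ = Qb ^ 2 * ((P : ℝ) ^ (1 - 2 * σ) * (5 * T + 3 + 36 * P)) := by rw [e1]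
      have e2 : (P : ℝ) ^ (1 - 2 * σ) * P = (P : ℝ) ^ (2 - 2 * σ) := by
        conv_lhs => rw [show (P : ℝ) ^ (1 - 2 * σ) * P = (P : ℝ) ^ (1 - 2 * σ) * (P : ℝ) ^ (1 : ℝ)
          by rw [Real.rpow_one]]
        rw [← Real.rpow_add hP0]; ring_nf
      have h2 : (P : ℝ) ^ (1 - 2 * σ) * (5 * T + 3 + 36 * P) ≤
          44 * (2 ^ K * T ^ ((2 - 2 * σ) + η)) := by
        calc (P : ℝ) ^ (1 - 2 * σ) * (5 * T + 3 + 36 * P) ≤ (P : ℝ) ^ (1 - 2 * σ) * (44 * P) :=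
              mul_le_mul_of_nonneg_left (by linarith) (by positivity)
          _ = 44 * ((P : ℝ) ^ (1 - 2 * σ) * P) := by ring
          _ = 44 * (P : ℝ) ^ (2 - 2 * σ) := by rw [e2]
          _ ≤ 44 * (2 ^ K * T ^ ((2 - 2 * σ) + η)) := by linarith [hP22]
      calc (A / V) ^ 2 * P * (5 * T + 3 + 36 * P)
          ≤ Qb ^ 2 * ((P : ℝ) ^ (1 - 2 * σ) * (5 * T + 3 + 36 * P)) := h1
        _ ≤ Qb ^ 2 * (44 * (2 ^ K * T ^ ((2 - 2 * σ) + η))) :=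
            mul_le_mul_of_nonneg_left h2 (by positivity)
        _ = 44 * (Qb ^ 2 * (2 ^ K * T ^ ((2 - 2 * σ) + η))) := by ring
    -- `1 + log(2P) ≤ (K + 3) l`
    have hlogb : 1 + Real.log (2 * (P : ℝ)) ≤ (K + 3) * l := by
      have h1 : Real.log (2 * (P : ℝ)) ≤ Real.log Y₂ := Real.log_le_log (by positivity) h2P
      have h2 : Real.log Y₂ = K * Real.log 2 + (1 + η) * l := by
        rw [hY₂def, Real.log_mul (by positivity) (by positivity), Real.log_pow,
          Real.log_rpow hT0, ← hl]
      have hlog2 : Real.log 2 ≤ 1 := by have := Real.log_two_lt_d9; linarith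
      have h3 : (K : ℝ) * Real.log 2 ≤ K := mul_le_of_le_one_right hK0.le hlog2
      have h4 : (1 + η) * l ≤ 2 * l := mul_le_mul_of_nonneg_right (by linarith) hl0.le
      have h5 : (1 : ℝ) + K ≤ (K + 1) * l := by
        have := mul_le_mul_of_nonneg_left hl1 (show (0 : ℝ) ≤ K + 1 by positivity)
        rw [mul_one] at this
        linarith
      calc 1 + Real.log (2 * (P : ℝ)) ≤ 1 + Real.log Y₂ := by linarith
        _ = 1 + ((K : ℝ) * Real.log 2 + (1 + η) * l) := by rw [h2]
        _ ≤ 1 + (K + 2 * l) := by linarith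
        _ = (1 + K) + 2 * l := by ring
        _ ≤ (K + 1) * l + 2 * l := by linarith
        _ = (K + 3) * l := by ring
    have hlog0 : 0 ≤ 1 + Real.log (2 * (P : ℝ)) := by
      have : 0 ≤ Real.log (2 * (P : ℝ)) := Real.log_nonneg (by linarith)
      linarith
    have hQb2' : Qb ^ 2 = Q₁ ^ 2 * l ^ (2 * K) * T ^ (4 * η) := by
      rw [hQb, mul_pow, mul_pow, ← pow_mul, rpow_pow_eq hT0.le]; push_cast; ring_nf
    have hTT : T ^ (4 * η) * T ^ ((2 - 2 * σ) + η) = T ^ ((2 - 2 * σ) + 5 * η) := by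
      rw [← Real.rpow_add hT0]; ring_nf
    calc (W.card : ℝ)
        ≤ V⁻¹ ^ 2 * (A ^ 2 * P * ((5 * T + 3 + 36 * P) * (1 + Real.log (2 * (P : ℝ))))) := hMVT
      _ = ((A / V) ^ 2 * P * (5 * T + 3 + 36 * P)) * (1 + Real.log (2 * (P : ℝ))) := by ring
      _ ≤ (44 * (Qb ^ 2 * (2 ^ K * T ^ ((2 - 2 * σ) + η)))) * ((K + 3) * l) :=
          mul_le_mul hgeom hlogb hlog0 (by positivity)
      _ = 44 * (K + 3) * 2 ^ K * Q₁ ^ 2 *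
            ((l ^ (2 * K) * l) * (T ^ (4 * η) * T ^ ((2 - 2 * σ) + η))) := by
          rw [hQb2']; ring
      _ = 44 * (K + 3) * 2 ^ K * Q₁ ^ 2 * (l ^ (2 * K + 1) * T ^ ((2 - 2 * σ) + 5 * η)) := by
          rw [hTT]; ring
      _ ≤ R_L + 44 * (K + 3) * 2 ^ K * Q₁ ^ 2 *
            (l ^ (2 * K + 1) * T ^ ((2 - 2 * σ) + 5 * η)) := le_add_of_nonneg_left hRL

/-! ## §3. The class (ii) zeros for every `σ > 1/2` -/

/-- **The class (ii) bound made explicit for every `δ₀ = σ − 1/2 > 0`** (the variant of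
`GuthMaynardWindow.classTwo_numeric_gm` without `δ₀ ≥ 1/5`; the constant carries `δ₀⁻⁴`): with
`A = 100 log T`, `T = 2U`, `X ≤ 2T^η`, `W₀ = δ₀ T^v/2²⁰` and `1 − 4v ≤ κ`, the bound of
`HuxleyIvic.classTwo_fourth_le` is at most `K₂ δ₀⁻⁴ (3/η)³ T^{κ+13η}`.
[cite: GuthMaynard2026, Section 13, proof of Theorem 1.2] -/
theorem classTwo_numeric_dh {T U l A W₀ δ v κ η C₄ : ℝ} {X : ℕ} (hT : T = 2 * U) (hU1 : 1 ≤ U)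
    (hl : l = Real.log T) (hl1 : 1 ≤ l) (hA : A = 100 * l) (hη : 0 < η) (hη1 : η ≤ 1)
    (hXpos : 0 < (X : ℝ)) (hXup : (X : ℝ) ≤ 2 * T ^ η)
    (hW₀ : W₀ = δ * T ^ v / 2 ^ 20) (hδ : 0 < δ) (E3 : 1 - 4 * v ≤ κ) (hC40 : 0 ≤ C₄) :
    2 * A * (C₄ * (3 * U) ^ (1 + η)) * ((2 * A * (X : ℝ) ^ 2) ^ 2 / W₀ ^ 4) ≤
      (200 * C₄ * 4 * 640000 * (δ⁻¹ ^ 4 * 2 ^ 80)) * ((3 : ℕ) / η) ^ 3 * T ^ (κ + 13 * η) := by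
  have hT0 : 0 < T := by rw [hT]; linarith
  have hT1 : 1 ≤ T := by rw [hT]; linarith
  have hl0 : 0 < l := by linarith
  have hW₀0 : 0 < W₀ := by rw [hW₀]; positivity
  have h3U : (3 * U) ^ (1 + η) ≤ 4 * T ^ (1 + η) := by
    calc (3 * U) ^ (1 + η) ≤ (2 * T) ^ (1 + η) :=
          Real.rpow_le_rpow (by positivity) (by rw [hT]; linarith) (by positivity)
      _ = (2 : ℝ) ^ (1 + η) * T ^ (1 + η) := Real.mul_rpow (by norm_num) hT0.le
      _ ≤ 4 * T ^ (1 + η) := by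
          refine mul_le_mul_of_nonneg_right ?_ (by positivity)
          calc (2 : ℝ) ^ (1 + η) ≤ (2 : ℝ) ^ (2 : ℝ) :=
                Real.rpow_le_rpow_of_exponent_le (by norm_num) (by linarith)
            _ = 4 := by norm_num
  have hT2η : (T ^ η) ^ 2 = T ^ (2 * η) := by
    rw [← Real.rpow_natCast (T ^ η), ← Real.rpow_mul hT0.le]; push_cast; ring_nf
  have hT4η : (T ^ (2 * η)) ^ 2 = T ^ (4 * η) := by
    rw [← Real.rpow_natCast (T ^ (2 * η)), ← Real.rpow_mul hT0.le]; push_cast; ring_nf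
  have hX2 : (X : ℝ) ^ 2 ≤ 4 * T ^ (2 * η) := by
    calc (X : ℝ) ^ 2 ≤ (2 * T ^ η) ^ 2 := pow_le_pow_left₀ hXpos.le hXup 2
      _ = 4 * (T ^ η) ^ 2 := by ring
      _ = 4 * T ^ (2 * η) := by rw [hT2η]
  have hnum : (2 * A * (X : ℝ) ^ 2) ^ 2 ≤ 640000 * l ^ 2 * T ^ (4 * η) := by
    have h1 : 2 * A * (X : ℝ) ^ 2 ≤ 2 * (100 * l) * (4 * T ^ (2 * η)) := by
      rw [hA]; exact mul_le_mul_of_nonneg_left hX2 (by positivity)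
    calc (2 * A * (X : ℝ) ^ 2) ^ 2 ≤ (2 * (100 * l) * (4 * T ^ (2 * η))) ^ 2 :=
          pow_le_pow_left₀ (by rw [hA]; positivity) h1 2
      _ = 640000 * l ^ 2 * (T ^ (2 * η)) ^ 2 := by ring
      _ = 640000 * l ^ 2 * T ^ (4 * η) := by rw [hT4η]
  have hT4v0 : 0 < T ^ (4 * v) := Real.rpow_pos_of_pos hT0 _
  have hW₀4 : T ^ (4 * v) / (δ⁻¹ ^ 4 * 2 ^ 80) ≤ W₀ ^ 4 := by
    have h4 : (T ^ v) ^ 4 = T ^ (4 * v) := by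
      rw [← Real.rpow_natCast (T ^ v), ← Real.rpow_mul hT0.le]; push_cast; ring_nf
    have e : W₀ ^ 4 = T ^ (4 * v) / (δ⁻¹ ^ 4 * 2 ^ 80) := by
      rw [hW₀, div_pow, mul_pow, h4]
      field_simp
    rw [e]
  have hfrac : (2 * A * (X : ℝ) ^ 2) ^ 2 / W₀ ^ 4 ≤
      (640000 * l ^ 2 * T ^ (4 * η)) / (T ^ (4 * v) / (δ⁻¹ ^ 4 * 2 ^ 80)) :=
    div_le_div₀ (by positivity) hnum (by positivity) hW₀4
  have hexp : T ^ (1 + η) * T ^ (4 * η) / T ^ (4 * v) ≤ T ^ (κ + 5 * η) := by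
    rw [← Real.rpow_add hT0, ← Real.rpow_sub hT0]
    refine Real.rpow_le_rpow_of_exponent_le hT1 ?_
    linarith
  have hl3 : l ^ 3 ≤ ((3 : ℕ) / η) ^ 3 * T ^ η := by
    have := log_pow_le hT1 hη (p := 3) (by norm_num)
    rw [← hl] at this
    exact_mod_cast this
  have hTT : T ^ η * T ^ (κ + 5 * η) ≤ T ^ (κ + 13 * η) := by
    rw [← Real.rpow_add hT0]; exact Real.rpow_le_rpow_of_exponent_le hT1 (by linarith)
  have hA0 : 0 < A := by rw [hA]; positivity
  have hδi : 0 < δ⁻¹ ^ 4 * (2 : ℝ) ^ 80 := by positivity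
  calc 2 * A * (C₄ * (3 * U) ^ (1 + η)) * ((2 * A * (X : ℝ) ^ 2) ^ 2 / W₀ ^ 4)
      ≤ 2 * (100 * l) * (C₄ * (4 * T ^ (1 + η))) *
        ((640000 * l ^ 2 * T ^ (4 * η)) / (T ^ (4 * v) / (δ⁻¹ ^ 4 * 2 ^ 80))) := by
        rw [hA]; rw [hA] at hfrac; gcongr
    _ = (200 * C₄ * 4 * 640000 * (δ⁻¹ ^ 4 * 2 ^ 80)) * l ^ 3 *
          (T ^ (1 + η) * T ^ (4 * η) / T ^ (4 * v)) := by
        field_simp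
        ring
    _ ≤ (200 * C₄ * 4 * 640000 * (δ⁻¹ ^ 4 * 2 ^ 80)) * l ^ 3 * T ^ (κ + 5 * η) := by gcongr
    _ ≤ (200 * C₄ * 4 * 640000 * (δ⁻¹ ^ 4 * 2 ^ 80)) * (((3 : ℕ) / η) ^ 3 * T ^ η) *
          T ^ (κ + 5 * η) := by gcongr
    _ = (200 * C₄ * 4 * 640000 * (δ⁻¹ ^ 4 * 2 ^ 80)) * ((3 : ℕ) / η) ^ 3 *
          (T ^ η * T ^ (κ + 5 * η)) := by ring
    _ ≤ (200 * C₄ * 4 * 640000 * (δ⁻¹ ^ 4 * 2 ^ 80)) * ((3 : ℕ) / η) ^ 3 * T ^ (κ + 13 * η) := by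
        gcongr

/-! ## §4. The count of a well-separated set of zeros -/

set_option maxHeartbeats 1600000 in
/-- **The count of a well-separated set of zeros, given density-strength large values on
`[T^{2/3}, T]`** (TTY Corollary 43 at `τ₀ = 3/2`, finitary, in the tree's zero-detection
normalisation of `GuthMaynardWindow.card_sep_le_gm`: `X = T^η`, `Y = T^{1/2}`, `T = 2U`; a class
(i) zero has a dyadic block `(M, 2M]`, `X ≤ M ≤ 100 log T · Y`, whose `k`-th power
(`T^{2/3} ≤ M^k ≤ 2^K T^{1+η}`) is large, and after removing the real part (`taylor_pigeonhole`) its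
ordinate is counted on each sub-block by the HYPOTHESIS (sub-block `≤ T`, threshold `≥ P^{σ−d}`
because `6η ≤ d`) or by the mean value theorem (sub-block `> T`); the class (ii) zeros are counted
by the fourth moment of `ζ`). For `1/2 < σ ≤ 1`, `0 < η ≤ 1/100`, `6η ≤ d`, `0 ≤ ε₁` and the
hypothesis "for `T ≥ T₀`, `T^{2/3} ≤ N ≤ T`, `1`-bounded `b`, `1`-separated `W ⊂ [0, T]` with
`|∑_{N≤n≤2N} b_n n^{it}| ≥ N^{σ−d}` on `W`: `#W ≤ C_L T^{2(1−σ)+ε₁}`" there are `U₀, C` such that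
every finite set of zeros `ρ = β + iγ` of `ζ` with `β ≥ σ`, `U < γ ≤ 2U` (`U ≥ U₀`), ordinates
pairwise `≥ 300 log 2U` apart, has at most `C (2U)^{2−2σ+ε₁+13η}` elements.
[cite: TaoTrudgianYang2025, Lemma 39 and Corollary 43] [cite: GuthMaynard2026, Section 13.1] -/
theorem card_sep_le_dh (h4 : zetaFourthMomentWeak) {σ : ℝ} (hσ : 1 / 2 < σ) (hσ1 : σ ≤ 1)
    {η d ε₁ C_L T₀ : ℝ} (hη : 0 < η) (hη1 : η ≤ 1 / 100) (hηd : 6 * η ≤ d) (hε₁ : 0 ≤ ε₁)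
    (hCL0 : 0 ≤ C_L)
    (hLV : ∀ T : ℝ, T₀ ≤ T → ∀ (N : ℕ) (b : ℕ → ℂ) (W : Finset ℝ),
      T ^ (2 / 3 : ℝ) ≤ (N : ℝ) → (N : ℝ) ≤ T → (∀ n, ‖b n‖ ≤ 1) → (∀ t ∈ W, 0 ≤ t ∧ t ≤ T) →
      (∀ t ∈ W, ∀ t' ∈ W, t ≠ t' → 1 ≤ |t - t'|) →
      (∀ t ∈ W, (N : ℝ) ^ (σ - d) ≤
        ‖∑ n ∈ Finset.Icc N (2 * N), b n * (n : ℂ) ^ ((t : ℂ) * I)‖) →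
      (W.card : ℝ) ≤ C_L * T ^ (2 - 2 * σ + ε₁)) :
    ∃ U₀ C : ℝ, 1 ≤ U₀ ∧ 0 ≤ C ∧ ∀ U : ℝ, U₀ ≤ U → ∀ Z : Finset ℂ,
      (∀ ρ ∈ Z, riemannZeta ρ = 0 ∧ σ ≤ ρ.re ∧ U < ρ.im ∧ ρ.im ≤ 2 * U) →
      (∀ ρ ∈ Z, ∀ ρ' ∈ Z, ρ ≠ ρ' → 3 * (100 * Real.log (2 * U)) ≤ |ρ.im - ρ'.im|) →
      (Z.card : ℝ) ≤ C * (2 * U) ^ (2 - 2 * σ + ε₁ + 13 * η) := by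
  classical
  -- ### constants
  obtain ⟨C₄', hC4'⟩ := h4 η hη
  set C₄ : ℝ := max C₄' 0 with hC4def
  have hC40 : 0 ≤ C₄ := le_max_right _ _
  have hC4 : ∀ T : ℝ, 1 ≤ T → ∫ t in (0 : ℝ)..T, ‖riemannZeta (1 / 2 + t * I)‖ ^ 4 ≤ C₄ * T ^ (1 + η) :=
    fun T hT ↦ (hC4' T hT).trans (mul_le_mul_of_nonneg_right (le_max_left _ _) (by positivity))
  set K : ℕ := ⌈2 / η⌉₊ with hKdef
  have hK2 : 2 / η ≤ K := Nat.le_ceil _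
  have h1η : (1 : ℝ) ≤ 1 / η := by rw [le_div_iff₀ hη]; nlinarith
  have h2η : (2 : ℝ) ≤ 2 / η := by rw [le_div_iff₀ hη]; nlinarith
  have hK1 : 1 ≤ K := by
    have : (1 : ℝ) ≤ K := le_trans (by linarith) hK2
    exact_mod_cast this
  have hK0 : (0 : ℝ) < K := by exact_mod_cast hK1
  have hKη : 1 / η + 1 ≤ (K : ℝ) := by
    have : 2 / η = 1 / η + 1 / η := by ring
    linarith
  set θ : ℝ := η / (2 * K) with hθdef
  have hθ0 : 0 < θ := by positivity
  have hθK : 2 * K * θ = η := by rw [hθdef]; field_simp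
  obtain ⟨C_d, hCd1, hCd⟩ := Literature.NumberTheory.Sieve.exists_card_divisors_le_mul_rpow' hθ0
  -- exponents
  set κ : ℝ := 2 - 2 * σ + ε₁ with hκ
  have hκ0 : 0 ≤ κ := by rw [hκ]; linarith
  set δ : ℝ := σ - 1 / 2 with hδ
  set v : ℝ := 1 / 2 * δ with hv
  have hδ0 : 0 < δ := by rw [hδ]; linarith
  have E3 : 1 - 4 * v ≤ κ := by rw [hv, hδ]; linarith
  set E : ℝ := (C_d ^ 2) ^ K with hEdef
  have hE1 : 1 ≤ E := one_le_pow₀ (one_le_pow₀ hCd1)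
  have hE0 : 0 < E := by linarith
  set Q₁ : ℝ := 4 * K * 51 ^ K * 2 ^ K * E with hQ₁
  set R₁ : ℝ := C_L + 44 * (K + 3) * 2 ^ K * Q₁ ^ 2 with hR₁
  have hR₁0 : 0 ≤ R₁ := by rw [hR₁]; positivity
  set p : ℕ := 2 * K + 3 with hpdef
  have hp1 : 1 ≤ p := by omega
  set K₁ : ℝ := 17 * K * (2 * K + 9) * R₁ * ((p : ℝ) / η) ^ p with hK₁
  have hK₁0 : 0 ≤ K₁ := by rw [hK₁]; positivity
  set K₂ : ℝ := 200 * C₄ * 4 * 640000 * (δ⁻¹ ^ 4 * 2 ^ 80) with hK₂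
  set C : ℝ := K₁ + K₂ * ((3 : ℕ) / η) ^ 3 with hCdef
  have hC0 : 0 ≤ C := by positivity
  -- the threshold for the Taylor depth
  set Tn : ℝ := 8 * E * K * 204 ^ K with hTn
  -- ### thresholds
  set Cq : ℝ := Q₁ * ((K : ℝ) / η) ^ K with hCq
  obtain ⟨U₁, hU₁⟩ := Filter.eventually_atTop.1
    ((eventually_thresholds hη K 0 0).and ((eventually_ge_atTop Tn).and
      ((eventually_ge_atTop T₀).and ((eventually_ge_atTop (2 ^ 36 / δ + 3)).and
        ((tendsto_rpow_atTop hη).eventually_ge_atTop Cq)))))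
  refine ⟨max U₁ 1, C, le_max_right _ _, hC0, fun U hU Z hZ hsep ↦ ?_⟩
  obtain ⟨⟨hlT, hU38, h100l, hKlog2, -, -⟩, hUTn, hUT₀, hUδ, hUq⟩ :=
    hU₁ U (le_trans (le_max_left _ _) hU)
  have hU1 : 1 ≤ U := le_trans (by norm_num) hU38
  set T : ℝ := 2 * U with hT
  set l : ℝ := Real.log T with hl
  set A : ℝ := 100 * l with hA
  have hT1 : 1 ≤ T := by rw [hT]; linarith
  have hT0 : 0 < T := by linarith
  have hT4 : (10 : ℝ) ^ 4 ≤ T := by rw [hT]; linarith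
  have hUT : U ≤ T := by rw [hT]; linarith
  have hTT₀ : T₀ ≤ T := hUT₀.trans hUT
  have hTTn : Tn ≤ T := hUTn.trans hUT
  have hl1 : 1 ≤ l := by
    rw [hl, Real.le_log_iff_exp_le (by linarith)]; linarith [Real.exp_one_lt_d9]
  have hl0 : 0 < l := by linarith
  have hA0 : 0 < A := by positivity
  have hAU : A ≤ U := by rw [hA]; linarith
  have hTδ : 2 ^ 36 / (σ - 1 / 2) + 3 ≤ T := by rw [← hδ]; exact hUδ.trans hUT
  have hTpow : ∀ e : ℝ, T ^ e = Real.exp (e * l) := fun e ↦ by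
    rw [hl, Real.rpow_def_of_pos hT0]; ring_nf
  have hlT : l ≤ T := by
    rw [hl]; exact (Real.log_le_sub_one_of_pos hT0).trans (by linarith)
  -- the hypothesis at this `T`
  have hLVT := hLV T hTT₀
  -- `X`
  set X : ℕ := ⌈T ^ η⌉₊ with hXdef
  have hTη1 : 1 ≤ T ^ η := Real.one_le_rpow hT1 hη.le
  have hTη0 : 0 < T ^ η := by positivity
  have hXlow : T ^ η ≤ X := Nat.le_ceil _
  have hXup : (X : ℝ) ≤ 2 * T ^ η := by
    have := (Nat.ceil_lt_add_one hTη0.le).le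
    rw [← hXdef] at this; linarith
  have hX1 : 1 ≤ X := by
    have : (1 : ℝ) ≤ X := hTη1.trans hXlow
    exact_mod_cast this
  have hXpos : (0 : ℝ) < X := by exact_mod_cast hX1
  have hTηT : T ^ η ≤ T := Real.rpow_le_self_of_one_le hT1 (by linarith)
  have hXT2 : (X : ℝ) ≤ T ^ 2 := by nlinarith
  -- `Y = T^{1/2}`
  set Y : ℝ := T ^ (1 / 2 : ℝ) with hYdef
  have hY0 : 0 < Y := by positivity
  have hY10 : 10 ≤ Y := by
    calc (10 : ℝ) ≤ T ^ (1 / 4 : ℝ) := ten_le_rpow_quarter hT4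
      _ ≤ T ^ (1 / 2 : ℝ) := Real.rpow_le_rpow_of_exponent_le hT1 (by norm_num)
  have hY1 : 1 ≤ Y := by linarith
  have hYT2 : Y ≤ T ^ 2 := by
    calc Y ≤ T ^ (2 : ℝ) := Real.rpow_le_rpow_of_exponent_le hT1 (by norm_num)
      _ = T ^ 2 := by norm_cast
  have hYpow : ∀ e : ℝ, Y ^ e = T ^ (1 / 2 * e) := fun e ↦ by rw [hYdef, ← Real.rpow_mul hT0.le]
  -- `N₀`, `J`
  set N₀ : ℕ := ⌊100 * l * Y⌋₊ with hN₀
  have hN₀le : (N₀ : ℝ) ≤ 100 * l * Y := Nat.floor_le (by positivity)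
  set J : ℕ := Nat.log 2 N₀ + 1 with hJdef
  have hJ : N₀ < 2 ^ J := Nat.lt_pow_succ_log_self (by norm_num) N₀
  have hJ1 : 1 ≤ J := by rw [hJdef]; omega
  have hJ17 : (J : ℝ) ≤ 17 * l := by
    have h1 : (J : ℝ) = Nat.log 2 N₀ + 1 := by rw [hJdef]; push_cast; ring
    rw [h1]
    rcases Nat.eq_zero_or_pos N₀ with hN | hN
    · rw [hN]; simp; linarith
    · have hN₀1 : 1 ≤ N₀ := hN
      have hN₀pos : (0 : ℝ) < N₀ := by exact_mod_cast hN₀1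
      have hlogN₀ : Real.log N₀ ≤ 8 * l := by
        have h1 : (N₀ : ℝ) ≤ 100 * l * T ^ 2 := hN₀le.trans (by gcongr)
        have h2 : Real.log N₀ ≤ Real.log (100 * l * T ^ 2) := Real.log_le_log hN₀pos h1
        have h3 : Real.log (100 * l * T ^ 2) = Real.log 100 + Real.log l + 2 * Real.log T := by
          rw [Real.log_mul (by positivity) (by positivity), Real.log_mul (by norm_num) (by positivity),
            Real.log_pow]; push_cast; ring
        have h4 : Real.log l ≤ l := (Real.log_le_sub_one_of_pos hl0).trans (by linarith)
        rw [h3, ← hl] at h2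
        linarith [HuxleyZeroDensity.log_hundred_le]
      have h2 := HuxleyZeroDensity.natLog_two_le N₀ hN₀1
      linarith
  have hJ1r : (1 : ℝ) ≤ J := by exact_mod_cast hJ1
  have hJ0 : (0 : ℝ) < J := by linarith
  -- `Y₁`, `Y₂`, `W₀`
  set Y₁ : ℝ := T ^ (2 / 3 : ℝ) with hY₁def
  set Y₂ : ℝ := 2 ^ K * T ^ (1 + η) with hY₂def
  have hY₁1 : 1 ≤ Y₁ := Real.one_le_rpow hT1 (by linarith)
  have h2K1 : (1 : ℝ) ≤ 2 ^ K := one_le_pow₀ (by norm_num)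
  have hT2y1 : 1 ≤ T ^ (1 + η) := Real.one_le_rpow hT1 (by linarith)
  have hY₂1 : 1 ≤ Y₂ := one_le_mul_of_one_le_of_one_le h2K1 hT2y1
  have hY₂0 : 0 < Y₂ := by linarith
  set W₀ : ℝ := δ * Y ^ δ / 2 ^ 20 with hW₀
  have hW₀0 : 0 < W₀ := by positivity
  have hYδ : Y ^ δ = T ^ v := by rw [hYpow, hv]
  -- the zero-detecting coefficients
  set c : ℕ → ℂ := smoothed (mollCoeff X) Y with hc
  have hcd : ∀ n, ‖c n‖ ≤ (n.divisors.card : ℝ) := fun n ↦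
    (norm_smoothed_le _ hY0 n).trans (norm_mollCoeff_le X n)
  -- facts about the zeros
  have hre : ∀ ρ ∈ Z, σ ≤ ρ.re ∧ ρ.re ≤ 1 := fun ρ hρ ↦
    ⟨(hZ ρ hρ).2.1, (LFunctions.re_lt_one_of_riemannZeta_eq_zero (hZ ρ hρ).1).le⟩
  have him : ∀ ρ ∈ Z, 0 ≤ ρ.im ∧ ρ.im ≤ T := by
    intro ρ hρ
    have h1 := (hZ ρ hρ).2.2
    rw [hT]; constructor <;> linarith [h1.1, h1.2]
  have hsep1 : ∀ ρ ∈ Z, ∀ ρ' ∈ Z, ρ ≠ ρ' → 1 ≤ |ρ.im - ρ'.im| := by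
    intro ρ hρ ρ' hρ' hne
    have := hsep ρ hρ ρ' hρ' hne
    linarith only [this, hA0, hl1, hA]
  -- ### the two classes
  set ZI := Z.filter (fun ρ ↦ 1 / 3 < ‖∑ n ∈ Finset.Ioc X N₀, c n * (n : ℂ) ^ (-ρ)‖) with hZI
  set ZII := Z.filter (fun ρ ↦ W₀ ≤ ∫ y in (-A)..A,
      ‖riemannZeta (1 / 2 + ((ρ.im + y : ℝ) : ℂ) * I) * mollifier X (1 / 2 + ((ρ.im + y : ℝ) : ℂ) * I)‖)
    with hZII
  have hcover : Z ⊆ ZI ∪ ZII := by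
    intro ρ hρ
    obtain ⟨hζ, hβ, hγ1, hγ2⟩ := hZ ρ hρ
    have hγ : 100 * Real.log T ≤ |ρ.im| := by
      rw [abs_of_pos (by linarith)]; rw [← hl]; linarith
    have hγT : |ρ.im| ≤ T := by rw [abs_of_pos (by linarith)]; linarith
    have hdich := HuxleyZeroDensity.zeroDetection_integral hδ0 hTδ hX1 hXT2 hY10 hYT2 hζ
      (by rw [hδ]; linarith) hγ hγT
    rw [Finset.mem_union, hZI, hZII, Finset.mem_filter, Finset.mem_filter]
    rcases hdich with h1 | h2
    · exact Or.inl ⟨hρ, h1⟩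
    · right
      have h2' := h2
      rw [← hl, ← hA] at h2'
      have hW₀le : W₀ ≤ δ * Y ^ (ρ.re - 1 / 2) / 2 ^ 20 := by
        rw [hW₀]
        have : Y ^ δ ≤ Y ^ (ρ.re - 1 / 2) :=
          Real.rpow_le_rpow_of_exponent_le hY1 (by rw [hδ]; linarith)
        gcongr
      exact ⟨hρ, hW₀le.trans h2'⟩
  -- ### class (i): the power `k`
  have hkex : ∀ M : ℕ, X ≤ M → M < N₀ →
      ∃ k : ℕ, 1 ≤ k ∧ k ≤ K ∧ Y₁ ≤ (M : ℝ) ^ k ∧ (2 * (M : ℝ)) ^ k ≤ Y₂ := by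
    intro M hXM hMN
    have hM1 : (1 : ℝ) ≤ M := by exact_mod_cast hX1.trans hXM
    have hM0 : (0 : ℝ) < M := by linarith
    set m : ℝ := Real.log M with hm
    have hMexp : (M : ℝ) = Real.exp m := by rw [hm, Real.exp_log hM0]
    have hmlow : η * l ≤ m := by
      have h1 : T ^ η ≤ M := hXlow.trans (by exact_mod_cast hXM)
      have h2 : Real.log (T ^ η) ≤ m := Real.log_le_log hTη0 h1
      rwa [Real.log_rpow hT0, ← hl] at h2
    have hmup : 2 * m ≤ (1 + η) * l := by
      have h1 : (M : ℝ) ≤ 100 * l * Y := le_trans (by exact_mod_cast hMN.le) hN₀le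
      have h2 : 100 * l * Y ≤ T ^ (η / 2) * Y := by
        have h100l' : 100 * l ≤ T ^ (η / 2) := by rw [hA] at h100l; exact h100l
        exact mul_le_mul_of_nonneg_right h100l' hY0.le
      have h3 : T ^ (η / 2) * Y = T ^ (1 / 2 + η / 2) := by
        rw [hYdef, ← Real.rpow_add hT0]; ring_nf
      have h4 : m ≤ (1 / 2 + η / 2) * l := by
        have := Real.log_le_log hM0 ((h1.trans h2).trans h3.le)
        rwa [Real.log_rpow hT0, ← hl, ← hm] at this
      linarith
    obtain ⟨k, hk1, hkK, hkm1, hkm2⟩ := exists_power_gm (a₁ := 2 / 3) (a₂ := 1) hη hl0 hmlow hmup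
      (by norm_num) (by norm_num) (by norm_num) (by norm_num) hKη
    have hMk : (M : ℝ) ^ k = Real.exp (k * m) := by rw [hMexp, ← Real.exp_nat_mul]
    refine ⟨k, hk1, hkK, ?_, ?_⟩
    · rw [hMk, hY₁def, hTpow, Real.exp_le_exp]
      exact hkm1
    · rw [mul_pow, hMk, hY₂def, hTpow]
      exact mul_le_mul (pow_le_pow_right₀ (by norm_num) hkK) (Real.exp_le_exp.2 hkm2)
        (by positivity) (by positivity)
  -- ### class (i): the Taylor depth `n`
  set n : ℕ := ⌈(K + 4) * l / Real.log 2⌉₊ with hndef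
  have hlog2 : 0 < Real.log 2 := Real.log_pos (by norm_num)
  have hlog2' : 1 / 2 < Real.log 2 := by have := Real.log_two_gt_d9; linarith
  have hnlow : (K + 4) * l / Real.log 2 ≤ n := Nat.le_ceil _
  have hnq0 : 0 < (K + 4) * l / Real.log 2 := by positivity
  have hn1 : 1 ≤ n := by
    have : (0 : ℝ) < n := lt_of_lt_of_le hnq0 hnlow
    exact_mod_cast this
  have hnup : (n : ℝ) ≤ (2 * K + 9) * l := by
    have h1 : (n : ℝ) < (K + 4) * l / Real.log 2 + 1 := Nat.ceil_lt_add_one hnq0.le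
    have h2 : (K + 4) * l / Real.log 2 ≤ 2 * ((K + 4) * l) := by
      rw [div_le_iff₀ hlog2]
      have h0 : 0 ≤ ((K : ℝ) + 4) * l := by positivity
      have h3 : (1 : ℝ) ≤ 2 * Real.log 2 := by linarith only [hlog2']
      calc ((K : ℝ) + 4) * l = ((K + 4) * l) * 1 := by ring
        _ ≤ ((K + 4) * l) * (2 * Real.log 2) := mul_le_mul_of_nonneg_left h3 h0
        _ = 2 * ((K + 4) * l) * Real.log 2 := by ring
    have h4 : (0 : ℝ) ≤ K * l := by positivity
    linarith only [h1, h2, hl1, h4]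
  have h2n : 8 * (E * Y₂ ^ η * Y₂) * (K * (3 * (J : ℝ)) ^ K) ≤ 2 ^ n := by
    -- `2^n ≥ T^{K+4}`
    have h1 : T ^ ((K : ℝ) + 4) ≤ 2 ^ n := by
      rw [hTpow]
      have e : (2 : ℝ) ^ n = Real.exp (n * Real.log 2) := by
        rw [← Real.rpow_natCast, Real.rpow_def_of_pos (by norm_num)]; ring_nf
      rw [e, Real.exp_le_exp]
      rw [div_le_iff₀ hlog2] at hnlow
      exact hnlow
    refine le_trans ?_ h1
    -- `Y₂^η Y₂ ≤ 4^K T²`, `(3J)^K ≤ 51^K T^K`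
    have hY₂η : Y₂ ^ η ≤ 2 ^ K * T ^ (2 * η) := by
      rw [hY₂def, Real.mul_rpow (by positivity) (by positivity), ← Real.rpow_mul hT0.le]
      refine mul_le_mul ?_ (Real.rpow_le_rpow_of_exponent_le hT1
        (mul_le_mul_of_nonneg_right (by linarith) hη.le)) (by positivity)
        (by positivity)
      calc ((2 : ℝ) ^ K) ^ η ≤ ((2 : ℝ) ^ K) ^ (1 : ℝ) :=
            Real.rpow_le_rpow_of_exponent_le h2K1 (by linarith)
        _ = 2 ^ K := Real.rpow_one _
    have hY₂2 : Y₂ ^ η * Y₂ ≤ 4 ^ K * T ^ (2 : ℝ) := by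
      calc Y₂ ^ η * Y₂ ≤ (2 ^ K * T ^ (2 * η)) * (2 ^ K * T ^ (1 + η)) :=
            mul_le_mul_of_nonneg_right hY₂η hY₂0.le
        _ = (2 ^ K * 2 ^ K) * (T ^ (2 * η) * T ^ (1 + η)) := by ring
        _ = 4 ^ K * T ^ (2 * η + (1 + η)) := by
            rw [← mul_pow, ← Real.rpow_add hT0]; norm_num
        _ ≤ 4 ^ K * T ^ (2 : ℝ) :=
            mul_le_mul_of_nonneg_left (Real.rpow_le_rpow_of_exponent_le hT1 (by linarith))
              (by positivity)
    have hJK : (3 * (J : ℝ)) ^ K ≤ 51 ^ K * T ^ (K : ℝ) := by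
      rw [Real.rpow_natCast, ← mul_pow]
      refine pow_le_pow_left₀ (by positivity) ?_ K
      linarith only [hJ17, hlT]
    have hTK : T ^ (2 : ℝ) * T ^ (K : ℝ) * T = T ^ ((K : ℝ) + 3) := by
      rw [← Real.rpow_add hT0, mul_comm, ← Real.rpow_one_add' hT0.le (by positivity)]; ring_nf
    calc 8 * (E * Y₂ ^ η * Y₂) * (K * (3 * (J : ℝ)) ^ K)
        = 8 * E * K * ((Y₂ ^ η * Y₂) * (3 * (J : ℝ)) ^ K) := by ring
      _ ≤ 8 * E * K * ((4 ^ K * T ^ (2 : ℝ)) * (51 ^ K * T ^ (K : ℝ))) := by gcongr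
      _ = Tn * (T ^ (2 : ℝ) * T ^ (K : ℝ)) := by
          rw [hTn, show (204 : ℝ) ^ K = 4 ^ K * 51 ^ K by rw [← mul_pow]; norm_num]; ring
      _ ≤ T * (T ^ (2 : ℝ) * T ^ (K : ℝ)) := mul_le_mul_of_nonneg_right hTTn (by positivity)
      _ = T ^ ((K : ℝ) + 3) := by rw [← hTK]; ring
      _ ≤ T ^ ((K : ℝ) + 4) := Real.rpow_le_rpow_of_exponent_le hT1 (by linarith)
  -- ### class (i): the count
  -- `Q₁ log^K T ≤ T^{2η}`
  have hQ : (4 * K * 51 ^ K * 2 ^ K * E) * l ^ K ≤ T ^ (2 * η) := by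
    have hlK : l ^ K ≤ ((K : ℝ) / η) ^ K * T ^ η := by
      have := log_pow_le hT1 hη (p := K) hK1
      rw [← hl] at this
      exact this
    have hUη : Cq ≤ T ^ η := by
      refine hUq.trans (Real.rpow_le_rpow (by linarith) hUT hη.le)
    have hTη2 : T ^ η * T ^ η = T ^ (2 * η) := by rw [← Real.rpow_add hT0]; ring_nf
    calc (4 * K * 51 ^ K * 2 ^ K * E) * l ^ K = Q₁ * l ^ K := by rw [hQ₁]
      _ ≤ Q₁ * (((K : ℝ) / η) ^ K * T ^ η) := mul_le_mul_of_nonneg_left hlK (by positivity)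
      _ = Cq * T ^ η := by rw [hCq]; ring
      _ ≤ T ^ η * T ^ η := mul_le_mul_of_nonneg_right hUη (by positivity)
      _ = T ^ (2 * η) := hTη2
  set R₀ : ℝ := R₁ * (l ^ (2 * K + 1) * T ^ (κ + 5 * η)) with hR₀
  have hR₀0 : 0 ≤ R₀ := by rw [hR₀]; positivity
  have hblk : ∀ (P : ℕ) (a : ℕ → ℂ) (V : ℝ) (W : Finset ℝ), 1 ≤ P → Y₁ ≤ (P : ℝ) →
      2 * (P : ℝ) ≤ Y₂ →
      (∀ r ∈ Finset.Ioc P (2 * P), ‖a r‖ ≤ ((C_d ^ 2) ^ K) * Y₂ ^ η * (P : ℝ) ^ (-σ)) →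
      (1 / (3 * (J : ℝ))) ^ K / K / 4 ≤ V →
      (∀ t ∈ W, 0 ≤ t ∧ t ≤ T) → (∀ t ∈ W, ∀ t' ∈ W, t ≠ t' → 1 ≤ |t - t'|) →
      (∀ t ∈ W, V ≤ ‖∑ r ∈ Finset.Ioc P (2 * P), a r * (r : ℂ) ^ (-((t : ℂ) * I))‖) →
      (W.card : ℝ) ≤ R₀ := by
    intro P a V W hP hY₁P h2P ha hV hW hWsep hWlarge
    have hRL0 : 0 ≤ C_L * T ^ κ := by positivity
    have := block_count_dh (K := K) (J := J) hT1 hl hl1 hη hη1 hσ.le hσ1 hηd hRL0 hE1 hK1 hJ1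
      hJ17 hY₁def hY₂def hQ hLVT hP hY₁P h2P ha hV hW hWsep hWlarge
    refine this.trans ?_
    -- `C_L T^κ + M log^{2K+1}T · T^{2−2σ+5η} ≤ (C_L + M) log^{2K+1}T · T^{κ+5η}`
    have hfac1 : T ^ κ ≤ l ^ (2 * K + 1) * T ^ (κ + 5 * η) := by
      calc T ^ κ = 1 * T ^ κ := (one_mul _).symm
        _ ≤ l ^ (2 * K + 1) * T ^ (κ + 5 * η) :=
            mul_le_mul (one_le_pow₀ hl1) (Real.rpow_le_rpow_of_exponent_le hT1 (by linarith))
              (by positivity) (by positivity)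
    have hfac2 : l ^ (2 * K + 1) * T ^ ((2 - 2 * σ) + 5 * η) ≤ l ^ (2 * K + 1) * T ^ (κ + 5 * η) :=
      mul_le_mul_of_nonneg_left (Real.rpow_le_rpow_of_exponent_le hT1 (by rw [hκ]; linarith))
        (by positivity)
    calc C_L * T ^ κ + 44 * (K + 3) * 2 ^ K * (4 * K * 51 ^ K * 2 ^ K * E) ^ 2 *
          (l ^ (2 * K + 1) * T ^ ((2 - 2 * σ) + 5 * η))
        ≤ C_L * (l ^ (2 * K + 1) * T ^ (κ + 5 * η)) +
          44 * (K + 3) * 2 ^ K * Q₁ ^ 2 * (l ^ (2 * K + 1) * T ^ (κ + 5 * η)) := by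
          rw [← hQ₁]
          exact add_le_add (mul_le_mul_of_nonneg_left hfac1 hCL0)
            (mul_le_mul_of_nonneg_left hfac2 (by positivity))
      _ = R₀ := by rw [hR₀, hR₁]; ring
  have hI := classOne_card_le_gm hθ0.le hη.le hCd1 hCd hK1 hθK.le hcd (by linarith) hX1 hJ hY₁1
    hkex hn1 h2n hR₀0 hblk Z hre him hsep1
  rw [← hZI] at hI
  -- ### bounding the class (i) expression
  have hlp : l ^ p ≤ ((p : ℝ) / η) ^ p * T ^ η := log_pow_le hT1 hη hp1
  have hIfin : (ZI.card : ℝ) ≤ K₁ * T ^ (κ + 13 * η) := by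
    have h1 : (J : ℝ) * (K * (n * R₀)) ≤ (17 * l) * (K * (((2 * K + 9) * l) * R₀)) := by gcongr
    have e1 : (17 * l) * (K * (((2 * K + 9) * l) * R₀)) =
        17 * K * (2 * K + 9) * R₁ * (l ^ p * T ^ (κ + 5 * η)) := by
      rw [hR₀, hpdef]; ring
    have hTT : T ^ η * T ^ (κ + 5 * η) ≤ T ^ (κ + 13 * η) := by
      rw [← Real.rpow_add hT0]; exact Real.rpow_le_rpow_of_exponent_le hT1 (by linarith)
    calc (ZI.card : ℝ) ≤ _ := hI
      _ ≤ _ := h1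
      _ = 17 * K * (2 * K + 9) * R₁ * (l ^ p * T ^ (κ + 5 * η)) := e1
      _ ≤ 17 * K * (2 * K + 9) * R₁ * ((((p : ℝ) / η) ^ p * T ^ η) * T ^ (κ + 5 * η)) := by gcongr
      _ = K₁ * (T ^ η * T ^ (κ + 5 * η)) := by rw [hK₁]; ring
      _ ≤ K₁ * T ^ (κ + 13 * η) := mul_le_mul_of_nonneg_left hTT hK₁0
  -- ### class (ii)
  have hZII_Z : ∀ ρ ∈ ZII, U < ρ.im ∧ ρ.im ≤ 2 * U := fun ρ hρ ↦ by
    rw [hZII, Finset.mem_filter] at hρ; exact (hZ ρ hρ.1).2.2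
  have hsepII : ∀ ρ ∈ ZII, ∀ ρ' ∈ ZII, ρ ≠ ρ' → 2 * A ≤ |ρ.im - ρ'.im| := by
    intro ρ hρ ρ' hρ' hne
    rw [hZII, Finset.mem_filter] at hρ hρ'
    have := hsep ρ hρ.1 ρ' hρ'.1 hne; linarith
  have hlargeII : ∀ ρ ∈ ZII, W₀ ≤ ∫ y in (-A)..A,
      ‖riemannZeta (1 / 2 + ((ρ.im + y : ℝ) : ℂ) * I) * mollifier X (1 / 2 + ((ρ.im + y : ℝ) : ℂ) * I)‖ :=
    fun ρ hρ ↦ by rw [hZII, Finset.mem_filter] at hρ; exact hρ.2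
  have hW₀' : W₀ = δ * T ^ v / 2 ^ 20 := by rw [hW₀, hYδ]
  have hIIfin : (ZII.card : ℝ) ≤ K₂ * ((3 : ℕ) / η) ^ 3 * T ^ (κ + 13 * η) := by
    have hII := classTwo_fourth_le hU1 hA0 hAU hW₀0 hX1 ZII hZII_Z hsepII hlargeII hC4
    exact hII.trans (classTwo_numeric_dh hT hU1 hl hl1 hA hη (by linarith) hXpos hXup hW₀' hδ0
      E3 hC40)
  -- ### total
  have htot : (Z.card : ℝ) ≤ ZI.card + ZII.card := by
    exact_mod_cast (Finset.card_le_card hcover).trans (Finset.card_union_le _ _)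
  calc (Z.card : ℝ) ≤ ZI.card + ZII.card := htot
    _ ≤ K₁ * T ^ (κ + 13 * η) + K₂ * ((3 : ℕ) / η) ^ 3 * T ^ (κ + 13 * η) :=
        add_le_add hIfin hIIfin
    _ = C * T ^ (κ + 13 * η) := by rw [hCdef]; ring

/-! ## §5. Thinning, the window estimate, and the `O`-bound -/

/-- **A zero-density bound on `U < γ ≤ 2U` for `1`-separated zeros, given density-strength large
values on `[T^{2/3}, T]`** (thinning into classes of ordinates `≥ 300 log 2U` apart,
`k = ⌈300 log 2U⌉ + 1`, `HuxleyZeroDensity.card_le_of_thinning`; then `card_sep_le_dh` on each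
class and `log 2U ≤ η⁻¹(2U)^η`): with the data of `card_sep_le_dh` there are `U₀, C` with
`#Z ≤ C U^{2 − 2σ + ε₁ + 14η}` for every finite set `Z` of zeros `β + iγ` of `ζ`, `β ≥ σ`,
`U < γ ≤ 2U` (`U ≥ U₀`), ordinates pairwise `≥ 1` apart, provided `ε₁ + 14η ≤ 2σ − 1`.
[cite: TaoTrudgianYang2025, Lemma 39 and Corollary 43] -/
theorem wellSpaced_dh (h4 : zetaFourthMomentWeak) {σ : ℝ} (hσ : 1 / 2 < σ) (hσ1 : σ ≤ 1)
    {η d ε₁ C_L T₀ : ℝ} (hη : 0 < η) (hη1 : η ≤ 1 / 100) (hηd : 6 * η ≤ d) (hε₁ : 0 ≤ ε₁)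
    (hroom : ε₁ + 14 * η ≤ 2 * σ - 1) (hCL0 : 0 ≤ C_L)
    (hLV : ∀ T : ℝ, T₀ ≤ T → ∀ (N : ℕ) (b : ℕ → ℂ) (W : Finset ℝ),
      T ^ (2 / 3 : ℝ) ≤ (N : ℝ) → (N : ℝ) ≤ T → (∀ n, ‖b n‖ ≤ 1) → (∀ t ∈ W, 0 ≤ t ∧ t ≤ T) →
      (∀ t ∈ W, ∀ t' ∈ W, t ≠ t' → 1 ≤ |t - t'|) →
      (∀ t ∈ W, (N : ℝ) ^ (σ - d) ≤
        ‖∑ n ∈ Finset.Icc N (2 * N), b n * (n : ℂ) ^ ((t : ℂ) * I)‖) →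
      (W.card : ℝ) ≤ C_L * T ^ (2 - 2 * σ + ε₁)) :
    ∃ U₀ C : ℝ, 1 ≤ U₀ ∧ 0 ≤ C ∧ ∀ U : ℝ, U₀ ≤ U → ∀ Z : Finset ℂ,
      (∀ ρ ∈ Z, riemannZeta ρ = 0 ∧ σ ≤ ρ.re ∧ U < ρ.im ∧ ρ.im ≤ 2 * U) →
      (∀ ρ ∈ Z, ∀ ρ' ∈ Z, ρ ≠ ρ' → 1 ≤ |ρ.im - ρ'.im|) →
      (Z.card : ℝ) ≤ C * U ^ (2 - 2 * σ + ε₁ + 14 * η) := by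
  classical
  obtain ⟨U₀, C, hU₀, hC0, hbd⟩ := card_sep_le_dh h4 hσ hσ1 hη hη1 hηd hε₁ hCL0 hLV
  set κ : ℝ := 2 - 2 * σ + ε₁ with hκ
  have hk2 : κ + 14 * η ≤ 2 := by rw [hκ]; linarith
  refine ⟨U₀, 302 * C * (2 / η) * 4, hU₀, by positivity, fun U hU Z hZ hsep ↦ ?_⟩
  have hU1 : 1 ≤ U := hU₀.trans hU
  set T : ℝ := 2 * U with hT
  have hT2 : 2 ≤ T := by rw [hT]; linarith
  have hT0 : 0 < T := by linarith
  have hT1 : 1 ≤ T := by linarith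
  set l : ℝ := Real.log T with hl
  have hl0 : 0 ≤ l := Real.log_nonneg hT1
  set A : ℝ := 100 * l with hA
  set k : ℕ := ⌈3 * A⌉₊ + 1 with hk
  have hk1' : 1 ≤ k := by rw [hk]; omega
  have hkA : 3 * A ≤ (k : ℝ) - 1 := by
    rw [hk]; push_cast
    have := Nat.le_ceil (3 * A)
    linarith
  have hkle : (k : ℝ) ≤ 302 * l + 2 := by
    rw [hk]; push_cast
    have := (Nat.ceil_lt_add_one (by positivity : (0 : ℝ) ≤ 3 * A)).le
    rw [hA] at this; linarith
  -- thinning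
  have hpos : ∀ ρ ∈ Z, 0 ≤ ρ.im := fun ρ hρ ↦ by linarith [(hZ ρ hρ).2.2.1]
  have hB : ∀ Z' ⊆ Z, (∀ ρ ∈ Z', ∀ ρ' ∈ Z', ρ ≠ ρ' → (k : ℝ) - 1 ≤ |ρ.im - ρ'.im|) →
      (Z'.card : ℝ) ≤ C * T ^ (κ + 13 * η) := by
    intro Z' hZ' hsep'
    refine hbd U hU Z' (fun ρ hρ ↦ hZ ρ (hZ' hρ)) fun ρ hρ ρ' hρ' hne ↦ ?_
    rw [← hT, ← hl, ← hA]
    exact hkA.trans (hsep' ρ hρ ρ' hρ' hne)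
  have hthin := HuxleyZeroDensity.card_le_of_thinning Z hk1' hpos hsep hB
  -- `l + 1 ≤ (2/η) T^η`
  have hlog : l ≤ T ^ η / η := Real.log_le_rpow_div hT0.le hη
  have hTη1 : 1 ≤ T ^ η := Real.one_le_rpow hT1 hη.le
  have h1η : (1 : ℝ) ≤ 1 / η := by rw [le_div_iff₀ hη]; linarith
  have hl1' : l + 1 ≤ 2 / η * T ^ η := by
    have e : T ^ η / η = 1 / η * T ^ η := by ring
    rw [e] at hlog
    have : (1 : ℝ) ≤ 1 / η * T ^ η := one_le_mul_of_one_le_of_one_le h1η hTη1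
    have e2 : 2 / η * T ^ η = 2 * (1 / η * T ^ η) := by ring
    rw [e2]; linarith
  -- `T^{κ+14η} ≤ 4 U^{κ+14η}`
  have hTU : T ^ (κ + 14 * η) ≤ 4 * U ^ (κ + 14 * η) := by
    rw [hT, Real.mul_rpow (by norm_num) (by linarith)]
    refine mul_le_mul_of_nonneg_right ?_ (by positivity)
    calc (2 : ℝ) ^ (κ + 14 * η) ≤ (2 : ℝ) ^ (2 : ℝ) :=
          Real.rpow_le_rpow_of_exponent_le (by norm_num) (by linarith)
      _ = 4 := by norm_num
  have hTT : T ^ η * T ^ (κ + 13 * η) = T ^ (κ + 14 * η) := by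
    rw [← Real.rpow_add hT0]; congr 1; ring
  have hk302 : (k : ℝ) ≤ 302 * (l + 1) := by linarith
  calc (Z.card : ℝ) ≤ k * (C * T ^ (κ + 13 * η)) := hthin
    _ ≤ (302 * (l + 1)) * (C * T ^ (κ + 13 * η)) :=
        mul_le_mul_of_nonneg_right hk302 (by positivity)
    _ = 302 * C * (l + 1) * T ^ (κ + 13 * η) := by ring
    _ ≤ 302 * C * (2 / η * T ^ η) * T ^ (κ + 13 * η) := by gcongr
    _ = 302 * C * (2 / η) * (T ^ η * T ^ (κ + 13 * η)) := by ring
    _ = 302 * C * (2 / η) * T ^ (κ + 14 * η) := by rw [hTT]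
    _ ≤ 302 * C * (2 / η) * (4 * U ^ (κ + 14 * η)) := by gcongr
    _ = 302 * C * (2 / η) * 4 * U ^ (κ + 14 * η) := by ring

end ZeroDetectionDH

/-- **Zero detection at `τ₀ = 3/2` (Tao–Trudgian–Yang, Corollary 43 with `τ₀ = 3/2`; the classical
deduction of a density theorem from a large values theorem, Jutila 1977 §4 / Ivić 1985 §11.5),
finitary form.** Let `1/2 < σ < 1` and suppose DENSITY-HYPOTHESIS-STRENGTH LARGE VALUES at `σ` on
`T^{2/3} ≤ N ≤ T`: for every `ε > 0` there are `δ > 0`, `C`, `T₀` such that for `T ≥ T₀`, every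
`N` with `T^{2/3} ≤ N ≤ T`, every `1`-bounded `b` and every finite `1`-separated `W ⊂ [0, T]` on
which `|∑_{N≤n≤2N} b_n n^{it}| ≥ N^{σ−δ}`, `#W ≤ C T^{2(1−σ)+ε}` (TTY: `LV(σ, τ) ≤ 2τ(1−σ)` for
`1 ≤ τ ≤ 3/2`, Definition 27 in non-asymptotic form; verbatim the predicate `LargeValuesDHStrength σ`
of `Summits/RiemannHypothesis/RiemannHypothesis/Cruxes/DensityBelowBourgain/Lines/birth.lean`). Then
the density hypothesis holds at `σ`: `N(σ, T) = O_ε(T^{2(1−σ)+ε})` for every `ε > 0` — "Corollary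
43. Let `1/2 < σ < 1` and `τ₀ > 0`. Suppose … `LV(σ,τ) ≤ (3−3σ)τ/τ₀` for `2τ₀/3 ≤ τ ≤ τ₀`, and
`LV_ζ(σ,τ) ≤ (3−3σ)τ/τ₀` for `2 ≤ τ < 4τ₀/3`. Then `A(σ) ≤ 3/τ₀`", at `τ₀ = 3/2` where the second
condition is vacuous (proof of Theorem 45). This type is, binder for binder, the registered stub
`stub_zeroDetection_threeHalves` of that crux line with `LargeValuesDHStrength σ` unfolded.
[cite: TaoTrudgianYang2025, Corollary 43; Lemma 39; Definition 27; proof of Theorem 45] -/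
theorem isBigO_zetaZeroCountRe_of_largeValuesDHStrength {σ : ℝ} (h₁ : 1 / 2 < σ) (h₂ : σ < 1)
    (hLV : ∀ ε : ℝ, 0 < ε → ∃ δ C T₀ : ℝ, 0 < δ ∧ ∀ T : ℝ, T₀ ≤ T →
      ∀ (N : ℕ) (b : ℕ → ℂ) (W : Finset ℝ), T ^ (2 / 3 : ℝ) ≤ (N : ℝ) → (N : ℝ) ≤ T →
      (∀ n, ‖b n‖ ≤ 1) → (∀ t ∈ W, 0 ≤ t ∧ t ≤ T) →
      (∀ t ∈ W, ∀ t' ∈ W, t ≠ t' → 1 ≤ |t - t'|) →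
      (∀ t ∈ W, (N : ℝ) ^ (σ - δ) ≤
        ‖∑ n ∈ Finset.Icc N (2 * N), b n * (n : ℂ) ^ ((t : ℂ) * I)‖) →
      (W.card : ℝ) ≤ C * T ^ (2 * (1 - σ) + ε)) :
    ∀ ε > 0, (fun T : ℝ ↦ (zetaZeroCountRe σ T : ℝ)) =O[atTop] fun T : ℝ ↦ T ^ (2 * (1 - σ) + ε) := by
  intro ε hε
  have h4 : zetaFourthMomentWeak := zetaFourthMomentWeak_of_eq43 LFunctions.Bourgain2017_eq43_holds
  -- the tolerance fed to the hypothesis, and its window `δ`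
  set ε₁ : ℝ := min (ε / 4) ((2 * σ - 1) / 4) with hε₁def
  have hε₁0 : 0 < ε₁ := lt_min (by linarith) (by linarith)
  have hε₁ε : ε₁ ≤ ε / 4 := min_le_left _ _
  have hε₁σ : ε₁ ≤ (2 * σ - 1) / 4 := min_le_right _ _
  obtain ⟨δ, C_L', T₀, hδ, hLV'⟩ := hLV ε₁ hε₁0
  set C_L : ℝ := max C_L' 0 with hCLdef
  have hCL0 : 0 ≤ C_L := le_max_right _ _
  have hLV₁ : ∀ T : ℝ, T₀ ≤ T → ∀ (N : ℕ) (b : ℕ → ℂ) (W : Finset ℝ),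
      T ^ (2 / 3 : ℝ) ≤ (N : ℝ) → (N : ℝ) ≤ T → (∀ n, ‖b n‖ ≤ 1) → (∀ t ∈ W, 0 ≤ t ∧ t ≤ T) →
      (∀ t ∈ W, ∀ t' ∈ W, t ≠ t' → 1 ≤ |t - t'|) →
      (∀ t ∈ W, (N : ℝ) ^ (σ - δ) ≤
        ‖∑ n ∈ Finset.Icc N (2 * N), b n * (n : ℂ) ^ ((t : ℂ) * I)‖) →
      (W.card : ℝ) ≤ C_L * T ^ (2 - 2 * σ + ε₁) := by
    intro T hT N b W hN1 hN2 hb hW hsep hlarge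
    have hN0 : (0 : ℝ) ≤ T := (Nat.cast_nonneg N).trans hN2
    have h := hLV' T hT N b W hN1 hN2 hb hW hsep hlarge
    have e : 2 * (1 - σ) + ε₁ = 2 - 2 * σ + ε₁ := by ring
    rw [e] at h
    exact h.trans (mul_le_mul_of_nonneg_right (le_max_left _ _) (Real.rpow_nonneg hN0 _))
  -- `η`
  set η : ℝ := min (min (ε / 60) (δ / 6)) (min (1 / 100) ((2 * σ - 1) / 60)) with hηdef
  have hη0 : 0 < η := lt_min (lt_min (by linarith) (by linarith)) (lt_min (by norm_num) (by linarith))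
  have hηε : η ≤ ε / 60 := (min_le_left _ _).trans (min_le_left _ _)
  have hηδ : η ≤ δ / 6 := (min_le_left _ _).trans (min_le_right _ _)
  have hη1 : η ≤ 1 / 100 := (min_le_right _ _).trans (min_le_left _ _)
  have hησ : η ≤ (2 * σ - 1) / 60 := (min_le_right _ _).trans (min_le_right _ _)
  have hηd : 6 * η ≤ δ := by linarith
  have hroom : ε₁ + 14 * η ≤ 2 * σ - 1 := by linarith
  obtain ⟨U₀, C, hU₀, hC0, hws⟩ :=
    ZeroDetectionDH.wellSpaced_dh h4 h₁ h₂.le hη0 hη1 hηd hε₁0.le hroom hCL0 hLV₁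
  obtain ⟨C', hC'0, hwsb⟩ := ZeroDensity.wellSpacedBound_of_eventually
    (κ := 2 - 2 * σ + ε₁ + 14 * η) (by linarith) (by linarith) hU₀ hC0 hws
  obtain ⟨Cw, hCw0, hCw⟩ := LFunctions.exists_sum_zetaZeroWindow_le
  have hdy : ∀ U : ℝ, 1 ≤ U → (zetaZeroCountRe σ (2 * U) : ℝ) - zetaZeroCountRe σ U ≤
      (2 * C' * Cw) * U ^ (2 - 2 * σ + ε₁ + 14 * η) * Real.log (2 * U + 3) := by
    intro U hU
    have := ZeroDensity.count_dyadic_le (by linarith) hwsb hCw hU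
    calc (zetaZeroCountRe σ (2 * U) : ℝ) - zetaZeroCountRe σ U
        ≤ 2 * C' * U ^ (2 - 2 * σ + ε₁ + 14 * η) * (Cw * Real.log (2 * U + 3)) := this
      _ = (2 * C' * Cw) * U ^ (2 - 2 * σ + ε₁ + 14 * η) * Real.log (2 * U + 3) := by ring
  have hbig := ZeroDensity.isBigO_of_dyadic (κ := 2 - 2 * σ + ε₁ + 14 * η) (by linarith)
    (by positivity) hdy hη0
  refine hbig.trans (isBigO_rpow_rpow_atTop_of_le ?_)
  linarith

end Literature.NumberTheory.LFunctions

end
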